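import Summits.Parity.BatemanHorn.Theses.IsogenyRedei

/-!
# Route IsogenyRedei — `Assembly` (item stmt-Parity-11589)

The assembly item of route IsogenyRedei reads

`SplitBlockJacobi → PencilSelmerDictionary → QuadraticOmegaParity → PolyMobiusTail →
 TypeIMainTerm → LambdaToCount → BatemanHorn`.

The route's deciding theorem `IsogenyRedei.closes : PolyMobiusTail → TypeIMainTerm →
LambdaToCount → BatemanHorn` is already kernel-checked in the route file (the
`Λ = −(μ·log) ∗ 1` bookkeeping, the split of the divisor sum at `∏ dᵢ ≤ x^{1−η}`, then
`IsEquivalent.add_isLittleO` and `LambdaToCount`).  The assembly only weakens it by the three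
slice premises (`SplitBlockJacobi`, `PencilSelmerDictionary`, `QuadraticOmegaParity`), which are
discarded.  Honest shape, as recorded by the refuters on the item: the three slice cruxes are not
load-bearing for this implication; the deciding content of the route towards `BatemanHorn` is
`PolyMobiusTail` (stmt-Parity-0870) plus the theorem-grade glue 0873/0874.
-/

namespace Summit.Parity.BatemanHorn.Theorems

/-- **Assembly** (route IsogenyRedei, item stmt-Parity-11589):
`SplitBlockJacobi → PencilSelmerDictionary → QuadraticOmegaParity → PolyMobiusTail →
TypeIMainTerm → LambdaToCount → BatemanHorn`.  Proof: discard the first three premises and apply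
the route's proved deciding theorem `IsogenyRedei.closes`. -/
theorem isogenyRedei_assembly_proof :
    Summit.Parity.BatemanHorn.Theses.IsogenyRedei.Assembly := by
  unfold Summit.Parity.BatemanHorn.Theses.IsogenyRedei.Assembly
  intro _ _ _ hTail hMain hCount
  exact Summit.Parity.BatemanHorn.Theses.IsogenyRedei.closes hTail hMain hCount

end Summit.Parity.BatemanHorn.Theorems
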